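import Literature.MathematicalPhysics.QuantumFieldTheory.StrongCouplingTorusLimit
import Summits.QuantumFields.YangMills.Theorems.ConvexGribovBodyStrongCouplingShapeTruncated
import Summits.QuantumFields.YangMills.Theorems.ConvexGribovBodyStrongCouplingShapeGeometry

/-!
# Exponential clustering on the torus at strong coupling, uniformly in the volume

Support file for `StrongCouplingShape` (route `ConvexGribovBody`, item stmt-QuantumFields-8783):
the Osterwalder–Seiler analyticity mechanism for exponential clustering (Ann. Phys. 110 (1978),
Thm. 3.5), run directly on the torus plaquette system of `StrongCouplingTorusSystem` so that the
constants are manifestly independent of the volume.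

* `norm_truncated_le` (abstract plaquette system): the truncated expectation
  `⟨F₁F₂⟩_V(β) - ⟨F₁⟩_V(β)⟨F₂⟩_V(β)` is holomorphic and bounded by an explicit `K(F₁, F₂)` on the
  strong-coupling disc `‖β‖ < β_R`, uniformly in `V` (`PlaqSystem.norm_expect_le`), and vanishes
  to the order `k` of the shortest joining label set (`truncated_isBigO`); the Schwarz lemma
  with multiplicity (`norm_le_of_isBigO_pow`) gives `‖·‖ ≤ K 2^{-k}` for `‖β‖ ≤ β_R / 4`.
* `expect_ofReal_im`: expectations of real observables at real coupling are real.
* `card_seedsOf_le`: `|seedsOf B| ≤ |B| 2^d d²` (uniformity of `K` under translations).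
* `norm_torusTruncated_le`: on the torus of side `2s+1`, for observables supported within `r`
  of the origin along the axis `i` and a translate by `n ≤ s` units along `i`, the truncated
  torus expectation is at most `K 2^{-(n - 2r)}` for `‖β‖ ≤ betaOne d ρ / 4`, with `K`
  depending only on the sup norms and support sizes (`le_card_of_joins_torus`).
-/

noncomputable section

open MeasureTheory Filter Topology Finset Asymptotics
open Literature.MathematicalPhysics.QuantumFieldTheory

namespace Summit.QuantumFields.YangMills.Theorems.StrongCouplingShape

variable {d : ℕ} {G : Type*} {ι : Type*}

/-- `𝓙[S, B, R]`: the part of the label set `R` joined to the bond set `B` through `R`. -/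
local notation "𝓙[" S ", " B ", " R "]" =>
  Polymer.seedReach (PlaqSystem.Adj S) (PlaqSystem.Touches S B) R

/-- A product of observables living on `B₁` and `B₂` lives on `B₁ ∪ B₂`. [folklore] -/
theorem dependsOn_mul {B₁ B₂ : Finset (ZdEdge d)} {F₁ F₂ : ZdGaugeConfig d G → ℂ}
    (h₁B : DependsOn F₁ (B₁ : Set (ZdEdge d))) (h₂B : DependsOn F₂ (B₂ : Set (ZdEdge d))) :
    DependsOn (fun U => F₁ U * F₂ U) ((B₁ ∪ B₂ : Finset (ZdEdge d)) : Set (ZdEdge d)) := by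
  intro U V h
  have e1 : F₁ U = F₁ V :=
    h₁B fun i hi => h i (by simp only [Finset.coe_union, Set.mem_union]; exact Or.inl hi)
  have e2 : F₂ U = F₂ V :=
    h₂B fun i hi => h i (by simp only [Finset.coe_union, Set.mem_union]; exact Or.inr hi)
  show F₁ U * F₂ U = F₁ V * F₂ V
  rw [e1, e2]

/-! ### The Schwarz-lemma bound for an abstract plaquette system -/

section Abstract

variable [Group G] [TopologicalSpace G] [IsTopologicalGroup G] [CompactSpace G] [MeasurableSpace G]
  [BorelSpace G] [DecidableEq ι] {S : PlaqSystem d G ι} {M : ℝ} {D : ℕ}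

/-- **Exponential smallness of truncated expectations at strong coupling** (Osterwalder–Seiler's
analyticity argument, abstract plaquette system). If every label set of `V` joining the
supports of `F₁`, `F₂` has at least `k` labels and the seed sets of `B₁`, `B₂`, `B₁ ∪ B₂` have
at most `q` labels, then for `‖β‖ ≤ β_R / 4`,
`‖⟨F₁F₂⟩_V(β) - ⟨F₁⟩_V(β) ⟨F₂⟩_V(β)‖ ≤ 2 C₁ C₂ (2e^{1/2})^{2q} 2^{-k}`, uniformly in `V`:
holomorphy and the uniform bound on the disc `‖β‖ < β_R`, the order `k` at `0`, and the
Schwarz lemma on the disc of radius `β_R / 2`. [folklore] -/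
theorem norm_truncated_le (hR : S.Regular M D) {B₁ B₂ : Finset (ZdEdge d)}
    {F₁ F₂ : ZdGaugeConfig d G → ℂ} (h₁m : Measurable F₁) (h₂m : Measurable F₂) {C₁ C₂ : ℝ}
    (h₁b : ∀ U, ‖F₁ U‖ ≤ C₁) (h₂b : ∀ U, ‖F₂ U‖ ≤ C₂)
    (h₁B : DependsOn F₁ (B₁ : Set (ZdEdge d))) (h₂B : DependsOn F₂ (B₂ : Set (ZdEdge d)))
    (V : Finset ι) {k : ℕ}
    (hk : ∀ R ⊆ V, (¬ Disjoint B₁ B₂ ∨ ∃ p ∈ 𝓙[S, B₁, R], S.Touches B₂ p) → k ≤ R.card)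
    {q : ℕ} (hq₁ : (S.seedsOf B₁).card ≤ q) (hq₂ : (S.seedsOf B₂).card ≤ q)
    (hq₁₂ : (S.seedsOf (B₁ ∪ B₂)).card ≤ q) {β : ℂ} (hβ : ‖β‖ ≤ PlaqSystem.betaR M D / 4) :
    ‖S.expect (fun U => F₁ U * F₂ U) V β - S.expect F₁ V β * S.expect F₂ V β‖ ≤
      2 * C₁ * C₂ * (2 * Real.exp (1 / 2)) ^ (2 * q) * (1 / 2) ^ k := by
  set b := PlaqSystem.betaR M D with hb
  have hb0 : 0 < b := PlaqSystem.betaR_pos hR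
  set A : ℝ := 2 * Real.exp (1 / 2) with hA
  have hA1 : 1 ≤ A := by
    have := Real.one_le_exp (show (0 : ℝ) ≤ 1 / 2 by norm_num)
    rw [hA]; linarith
  have hC₁ : 0 ≤ C₁ := (norm_nonneg _).trans (h₁b fun _ => 1)
  have hC₂ : 0 ≤ C₂ := (norm_nonneg _).trans (h₂b fun _ => 1)
  have h₁₂m : Measurable fun U => F₁ U * F₂ U := h₁m.mul h₂m
  have h₁₂b : ∀ U, ‖F₁ U * F₂ U‖ ≤ C₁ * C₂ := fun U => by
    rw [norm_mul]; exact mul_le_mul (h₁b U) (h₂b U) (norm_nonneg _) hC₁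
  have h₁₂B := dependsOn_mul h₁B h₂B
  set K : ℝ := 2 * C₁ * C₂ * A ^ (2 * q) with hK
  -- the uniform bound on the disc
  have hbound : ∀ z ∈ Metric.ball (0 : ℂ) b,
      ‖S.expect (fun U => F₁ U * F₂ U) V z - S.expect F₁ V z * S.expect F₂ V z‖ ≤ K := by
    intro z hz
    rw [Metric.mem_ball, dist_zero_right] at hz
    have e12 := PlaqSystem.norm_expect_le hR hz.le h₁₂m h₁₂b h₁₂B V
    have e1 := PlaqSystem.norm_expect_le hR hz.le h₁m h₁b h₁B V
    have e2 := PlaqSystem.norm_expect_le hR hz.le h₂m h₂b h₂B V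
    have p12 : A ^ (S.seedsOf (B₁ ∪ B₂)).card ≤ A ^ (2 * q) :=
      pow_le_pow_right₀ hA1 (hq₁₂.trans (by omega))
    have p1 : A ^ (S.seedsOf B₁).card ≤ A ^ q := pow_le_pow_right₀ hA1 hq₁
    have p2 : A ^ (S.seedsOf B₂).card ≤ A ^ q := pow_le_pow_right₀ hA1 hq₂
    have hAq : 0 ≤ A ^ q := by positivity
    calc ‖S.expect (fun U => F₁ U * F₂ U) V z - S.expect F₁ V z * S.expect F₂ V z‖
        ≤ ‖S.expect (fun U => F₁ U * F₂ U) V z‖ + ‖S.expect F₁ V z‖ * ‖S.expect F₂ V z‖ := by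
          rw [← norm_mul]; exact norm_sub_le _ _
      _ ≤ C₁ * C₂ * A ^ (2 * q) + (C₁ * A ^ q) * (C₂ * A ^ q) := by
          refine add_le_add (e12.trans (mul_le_mul_of_nonneg_left p12 (mul_nonneg hC₁ hC₂)))
            (mul_le_mul (e1.trans (mul_le_mul_of_nonneg_left p1 hC₁))
              (e2.trans (mul_le_mul_of_nonneg_left p2 hC₂)) (norm_nonneg _) (by positivity))
      _ = K := by rw [hK]; ring
  -- holomorphy on the disc
  have hdiff : DifferentiableOn ℂ
      (fun z => S.expect (fun U => F₁ U * F₂ U) V z - S.expect F₁ V z * S.expect F₂ V z)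
      (Metric.ball 0 b) :=
    (PlaqSystem.differentiableOn_expect hR h₁₂m h₁₂b V).sub
      ((PlaqSystem.differentiableOn_expect hR h₁m h₁b V).mul
        (PlaqSystem.differentiableOn_expect hR h₂m h₂b V))
  -- the order at `0`
  have hO := truncated_isBigO hR h₁m h₂m h₁b h₂b h₁B h₂B V hk
  have hβr : ‖β‖ ≤ b / 2 := hβ.trans (by linarith)
  have h := norm_le_of_isBigO_pow hdiff hbound hO (r := b / 2) (by positivity) (by linarith) hβr
  refine h.trans (mul_le_mul_of_nonneg_left (pow_le_pow_left₀ (by positivity) ?_ k) ?_)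
  · rw [div_le_iff₀ (by positivity)]
    linarith
  · rw [hK]; positivity

omit [DecidableEq ι] in
/-- **Expectations of real observables at real coupling are real.** [folklore] -/
theorem expect_ofReal_im (f : ZdGaugeConfig d G → ℝ) (V : Finset ι) (β : ℝ) :
    (S.expect (fun U => ((f U : ℝ) : ℂ)) V (β : ℂ)).im = 0 := by
  have key : ∀ g : ZdGaugeConfig d G → ℝ, S.numZ (fun U => ((g U : ℝ) : ℂ)) V (β : ℂ) =
      ((∫ U, g U * ∏ p ∈ V, Real.exp (-(β * S.cost p U)) ∂(zdHaar d G) : ℝ) : ℂ) := by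
    intro g
    rw [PlaqSystem.numZ, ← integral_complex_ofReal]
    refine integral_congr_ae (Eventually.of_forall fun U => ?_)
    simp only [PlaqSystem.one_add_weight]
    push_cast
    rfl
  have h1 := key f
  have h2 : S.partZ V (β : ℂ) =
      ((∫ U, (1 : ℝ) * ∏ p ∈ V, Real.exp (-(β * S.cost p U)) ∂(zdHaar d G) : ℝ) : ℂ) := by
    rw [← key fun _ => (1 : ℝ), PlaqSystem.partZ]
    simp
  rw [PlaqSystem.expect, h1, h2, ← Complex.ofReal_div, Complex.ofReal_im]

end Abstract

/-! ### Seeds are few -/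

section Seeds

/-- **The number of seeds is proportional to the support**: at most `|B| 2^d d²` plaquette
labels of `ℤ^d` touch the bond set `B`. [folklore] -/
theorem card_seedsOf_le (B : Finset (ZdEdge d)) :
    (Plaq.seedsOf B).card ≤ B.card * (2 ^ d * (d * d)) := by
  unfold Plaq.seedsOf
  refine (Finset.card_filter_le _ _).trans (Finset.card_biUnion_le.trans ?_)
  refine (Finset.sum_le_sum (g := fun _ => 2 ^ d * (d * d)) fun e _ => ?_).trans ?_
  · have h2 : ∀ k : Fin d, (Finset.Icc (e.1 k - 1) (e.1 k)).card = 2 := fun k => by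
      rw [Int.card_Icc]; omega
    simp only [Finset.card_product, Fintype.card_piFinset, h2, Finset.prod_const,
      Finset.card_univ, Fintype.card_fin, le_refl]
  · rw [Finset.sum_const, smul_eq_mul]

end Seeds

/-! ### The torus -/

section Torus

variable {N : ℕ} [Group G] [TopologicalSpace G] [IsTopologicalGroup G] [CompactSpace G]
  [MeasurableSpace G] [BorelSpace G] {ρ : G →* Matrix (Fin N) (Fin N) ℂ}

/-- **Exponential clustering on the odd torus, uniformly in the volume.** Let `F₁` live on
`B_A` and `F₂` on the translate `{(x - v, j) : (x, j) ∈ B_B}` with `vᵢ = -n`, `n ≤ s`, where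
all `i`-th coordinates of `B_A ∪ B_B` are at most `r` in absolute value. Then on the torus of
side `2s+1`, for every complex coupling `‖β‖ ≤ betaOne d ρ / 4`, the truncated expectation of
the twisted observables in the torus plaquette system satisfies
`‖⟨F₁F₂⟩ - ⟨F₁⟩⟨F₂⟩‖ ≤ 2 C₁ C₂ (2e^{1/2})^{2q} 2^{-(n - 2r)}`, `q = (|B_A| + |B_B|) 2^d d²` —
constants independent of `s` and `n`. [folklore] -/
theorem norm_torusTruncated_le (hρ : Continuous ρ) (s n : ℕ) (hn : n ≤ s) (i : Fin d)
    {B_A B_B : Finset (ZdEdge d)} (v : Literature.Probability.LatticeModels.Site d)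
    (hv : v i = -(n : ℤ)) {F₁ F₂ : ZdGaugeConfig d G → ℂ} (h₁m : Measurable F₁)
    (h₂m : Measurable F₂) {C₁ C₂ : ℝ} (h₁b : ∀ U, ‖F₁ U‖ ≤ C₁) (h₂b : ∀ U, ‖F₂ U‖ ≤ C₂)
    (h₁B : DependsOn F₁ (B_A : Set (ZdEdge d)))
    (h₂B : DependsOn F₂ ((B_B.image fun e => (e.1 - v, e.2) : Finset (ZdEdge d)) : Set (ZdEdge d)))
    {r : ℕ} (hrA : ∀ e ∈ B_A, (e.1 i).natAbs ≤ r) (hrB : ∀ e ∈ B_B, (e.1 i).natAbs ≤ r)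
    {β : ℂ} (hβ : ‖β‖ ≤ betaOne d ρ / 4) :
    ‖(torusSystem ρ (2 * s + 1)).expect
          (fun U => F₁ (U ∘ torusRed (2 * s + 1)) * F₂ (U ∘ torusRed (2 * s + 1)))
          (torusGenuine d (2 * s + 1)) β -
        (torusSystem ρ (2 * s + 1)).expect (fun U => F₁ (U ∘ torusRed (2 * s + 1)))
            (torusGenuine d (2 * s + 1)) β *
          (torusSystem ρ (2 * s + 1)).expect (fun U => F₂ (U ∘ torusRed (2 * s + 1)))
            (torusGenuine d (2 * s + 1)) β‖ ≤
      2 * C₁ * C₂ * (2 * Real.exp (1 / 2)) ^ (2 * ((B_A.card + B_B.card) * (2 ^ d * (d * d)))) *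
        (1 / 2) ^ (n - 2 * r) := by
  set L := 2 * s + 1 with hL
  set T := torusSystem (G := G) ρ L with hT
  have hR : T.Regular (costBound ρ) (Plaq.degBound d) := torusSystem_regular ρ hρ
  set B₂ : Finset (ZdEdge d) := B_B.image fun e => (e.1 - v, e.2) with hB₂
  have h₁m' : Measurable fun U : ZdGaugeConfig d G => F₁ (U ∘ torusRed L) :=
    h₁m.comp (measurable_comp_relabel _)
  have h₂m' : Measurable fun U : ZdGaugeConfig d G => F₂ (U ∘ torusRed L) :=
    h₂m.comp (measurable_comp_relabel _)
  have h₁B' := dependsOn_comp_torusRed L h₁B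
  have h₂B' := dependsOn_comp_torusRed L h₂B
  have hq : ∀ {B : Finset (ZdEdge d)} {m : ℕ}, B.card ≤ m →
      (T.seedsOf (B.image (torusRed L))).card ≤ m * (2 ^ d * (d * d)) := fun {B m} hBm =>
    ((card_seedsOf_torusSystem_le ρ B).trans (card_seedsOf_le B)).trans
      (Nat.mul_le_mul_right _ hBm)
  have hB₂c : B₂.card ≤ B_B.card := Finset.card_image_le
  have hβ' : ‖β‖ ≤ PlaqSystem.betaR (costBound ρ) (Plaq.degBound d) / 4 := by
    rwa [betaR_costBound]
  refine norm_truncated_le hR h₁m' h₂m' (fun U => h₁b _) (fun U => h₂b _) h₁B' h₂B'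
    (torusGenuine d L) (k := n - 2 * r) (fun R _ hJ => ?_)
    (q := (B_A.card + B_B.card) * (2 ^ d * (d * d))) (hq (by omega)) (hq (by omega)) ?_ hβ'
  · exact le_card_of_joins_torus ρ i s n hn hrA hrB v hv hJ
  · rw [← Finset.image_union]
    exact hq ((Finset.card_union_le _ _).trans (by omega))

end Torus

end Summit.QuantumFields.YangMills.Theorems.StrongCouplingShape

end
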